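import Summits.BirchSwinnertonDyer.BirchSwinnertonDyer.Theorems.EisensteinPrimesResidualDevissageCountLower
import Summits.BirchSwinnertonDyer.BirchSwinnertonDyer.Theorems.EisensteinPrimesResidualDevissageCountSharp
import Summits.BirchSwinnertonDyer.BirchSwinnertonDyer.Theorems.EisensteinPrimesKellerYinLemma511NonsplitOfPrint
import Summits.BirchSwinnertonDyer.BirchSwinnertonDyer.Theorems.PrintCFramBottomClassIndexLawFiveLeEisensteinLambdaResidualBound
import Summits.BirchSwinnertonDyer.BirchSwinnertonDyer.Theorems.UniversalToricDescentLambdaTransport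
import Summits.BirchSwinnertonDyer.BirchSwinnertonDyer.Theorems.ResidualThetaTransportAtTwoLambdaHerbrandCount
import HarnessLib

/-!
# The residual dévissage COUNTED — `λ`-currency and the NON-SPLIT multiplicative datum: `p^{λ(X_ac^Σ(E))}` against
# `#R(Φ) · #R(E[p]/Φ)` in BOTH directions, with the anomalous local term `#((E[p]/Φ)^{G_{K_{∞,𝔭}}})^{p^c}` and the
# global term `#(E[p]/Φ)^{G_{K_∞}}`; at a non-split multiplicative Eisenstein prime the local term vanishes
# (cell `bsd-eis`, seat `bsd-line-x2-p2` gen 5, D-0154 KEY row 5; crux 4 `BSDpOnCellC` line b1; sequel of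
# `…ResidualDevissageCount{,Lower,Sharp}`; λ-currency via `PrintCFram.LambdaResidualBound` and UTD `LambdaTransport`)

HONEST FRAMING (cell `bsd-eis`, run/shared/lean/pub/bsd-eis/): bookkeeping on constructed objects plus one PROVED local fact
(p626493 §1); no definition, no named fact, no `sorry`, no `Theses` import; nothing about BSD or a main conjecture is
asserted; nothing booked; no label or count moves. Helper `--supports stmt-BirchSwinnertonDyer-19034`; closes no stub.
PRIOR ART IN THE TREE (read before writing): the counted dévissage UNDER the non-anomalous clause (S) and its
λ-currency `p^{λ(X_ac^Σ)} ≤ #R(Φ) · #R(E[p]/Φ)` are `PrintCFram.ResidualCounts.natCard_residualSelmer_le_mul_of_stableSubgroup`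
/ `PrintCFram.LambdaResidualBound.pow_lambdaInvariant_le_mul_natCard_residualSelmer_of_line` (cell `bsd-print-cfram`,
cfram-p1-w2 g3) — REUSED here, not re-proved. New here: the anomalous local term, the lower direction, the non-split datum.

`R(·) = R_𝔭^Σ(K_∞, ·) := datumStrictSelmer (ker κ) · p (AcSelmer.bdpData · p 𝔭) Σ`; `X_ac^Σ(E) = AcSelmer.XAc W p κ 𝔭 Σ γ` (the
Pontryagin dual of Castella's `Sel_𝔭^Σ(K_∞, E[p^∞])` = Keller–Yin's `𝔛^S_f` in the crux-4 dictionary); `Φ ≤ E[p]` `Γ_K`-stable.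

* §0 **`pow_lambdaInvariant_mul_natCard_pTorsion_eq`** — for `X = X_ac^Σ(E)` (finite `Σ`) with `Sel[p]` finite:
  **`p^{λ(X)} · #X[p] = #Sel_𝔭^Σ(K_∞, E[p^∞])[p]`** EXACTLY — Greenberg–Vatsal's «`λ = dim Sel[p]`» (p. 27) with the finite part
  `#X[p]` explicit instead of a «no finite `Λ`-submodule» hypothesis (RTT Herbrand count `#(X/pX) = p^λ · #X[p]` + exact Pontryagin
  `#(X/pX) = #Sel[p]`, `X` being the character module of `Sel`; torsion / `μ = 0` / `ℤ_p`-finiteness from `Sel[p]` finite, UTD).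
* §1 `natCard_residualSelmer_torsion_le_of_stableSubgroup_fixed` — **`#R(E[p]) ≤ #R(Φ) · #R(E[p]/Φ) · #((E[p]/Φ)^{G_{K_{∞,𝔭}}})^{p^c}`**
  (file 3 §2 for `B = E[p]`; `p^c` representatives above `𝔭`); **`pow_lambdaInvariant_le_of_stableSubgroup_fixed`**:
  `p^{λ(X_ac^Σ(E))} · #X[p] ≤` the same right-hand side (`p` odd, `Σ` finite ⊇ bad places prime to `p`, `D_𝔭 ⊄ ker κ`, (L) no
  `G_{K_{∞,𝔭}}`-fixed `p`-torsion in `E[p^∞]`) — the «`≤`» half of Keller–Yin Thm. 1.4.1 in λ-currency WITHOUT the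
  non-anomalous clause (anomalous good `p` = crux 2, split multiplicative `p` = crux 4's split half), local error named;
  **`mul_natCard_le_pow_lambdaInvariant_mul_of_surjective_fixed`**: the «`≥`» half
  **`#R(Φ) · #R(E[p]/Φ) ≤ p^{λ(X_ac^Σ(E))} · #X[p] · #(E[p]/Φ)^{G_{K_∞}}`** given the residual surjectivity — no «no finite
  submodule» hypothesis either.
* §2 `exists_stableSubgroup_noFixed_of_not_split` — at a NON-SPLIT multiplicative odd Eisenstein prime `p` of `W/ℚ`, over an
  imaginary quadratic `K` with `(p)` split, `v̄ ∣ p`, ANY `ℤ_p`-extension `κ`: the base change of a rational line is a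
  `Γ_K`-stable `S ≤ E_K[p]`, `#S = #(E_K[p]/S) = p`, with NO non-zero `ker κ ⊓ D_{v̄}`-fixed vector in `E_K[p]/S` (p626493 §1
  + CHL `LineBaseChange`/`TowerFixed`, isolated from g4's `residualFinite_of_prop14_of_not_split`); hence
  **`pow_lambdaInvariant_le_of_not_split`**: `p^{λ(X_ac^Σ(E_K))} ≤ #R(S) · #R(E_K[p]/S)` at every non-split multiplicative
  Eisenstein datum (Brink for the anticyclotomic `κ`, (L), the two residual groups finite) — NO error term (PrintCFram's bound with
  its clause discharged).

References: [KellerYin2024] Thm. 1.4.1, §5.1 (arXiv:2402.12781v2); [CastellaGrossiLeeSkinner2022] Thm. 3.2.1, Props. 14, 17, 18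
(arXiv:2008.02571); [GreenbergVatsal2000] §2 Prop. (2.8); [SilvermanATAEC1994] V.5.3–5.4; [Brink2007] Cor. 1; cell p626493,
p628626 (g4), PrintCFram `…EisensteinResidualCounts` / `…LambdaResidualBound` (cfram-p1-w2 g3), UTD `…LambdaTransport`.
-/

set_option autoImplicit false
set_option linter.dupNamespace false -- the summit namespace `…BirchSwinnertonDyer.BirchSwinnertonDyer.Theorems` (Sub = Summit, D-0017) trips it

noncomputable section

open scoped Classical Pointwise AddSubgroup

namespace Summit.BirchSwinnertonDyer.BirchSwinnertonDyer.Theorems.ResidualDevissageCountNonsplit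

open WeierstrassCurve NumberField IsDedekindDomain Field
  Literature.NumberTheory.EllipticCurves Literature.NumberTheory.EllipticCurves.IwasawaAlgebra
  Literature.NumberTheory.EllipticCurves.GreenbergSelmer
  Literature.NumberTheory.EllipticCurves.GreenbergVatsal2000
  Literature.NumberTheory.GaloisRepresentations IsDedekindDomain.HeightOneSpectrum
  Literature.NumberTheory.EllipticCurves.Rank1Residual
  Literature.NumberTheory.EllipticCurves.FineSelmerCoefficientMap
  Summit.BirchSwinnertonDyer.Rank1Residual.X11b Summit.BirchSwinnertonDyer.Rank1Residual.X11b.AcSelmer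
  Summit.BirchSwinnertonDyer.Rank1Residual.X2.ResidualDevissageModules
  Summit.BirchSwinnertonDyer.BirchSwinnertonDyer.Theorems
  Summit.BirchSwinnertonDyer.BirchSwinnertonDyer.Theorems.CumulativeHeegnerInclusionAtThreeResidualDevissage
  Summit.BirchSwinnertonDyer.BirchSwinnertonDyer.Theorems.CumulativeHeegnerInclusionAtThreeLineBaseChange
  Summit.BirchSwinnertonDyer.BirchSwinnertonDyer.Theorems.CumulativeHeegnerInclusionAtThreeTowerFixed
  Summit.BirchSwinnertonDyer.BirchSwinnertonDyer.Theorems.CumulativeHeegnerInclusionAtThreeStubB1Devissage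
  Summit.BirchSwinnertonDyer.BirchSwinnertonDyer.Theorems.CumulativeHeegnerInclusionAtThreeStubB1DevissageNamed
  Summit.BirchSwinnertonDyer.BirchSwinnertonDyer.Theorems.CumulativeHeegnerInclusionAtThreeStubB1LineDeterminant
  Summit.BirchSwinnertonDyer.BirchSwinnertonDyer.Theorems.CumulativeHeegnerInclusionAtThreeBadPlaces
  Summit.BirchSwinnertonDyer.BirchSwinnertonDyer.Theorems.AdditiveKoly.SplitCompletion
  Summit.BirchSwinnertonDyer.BirchSwinnertonDyer.Theorems.UniversalToricDescentResidualSelmer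
  Summit.BirchSwinnertonDyer.BirchSwinnertonDyer.Theorems.ResidualDevissageFiniteKernel
  Summit.BirchSwinnertonDyer.BirchSwinnertonDyer.Theorems.ResidualDevissageCount
  Summit.BirchSwinnertonDyer.BirchSwinnertonDyer.Theorems.KellerYinLemma511NonsplitOfPrint
  Summit.BirchSwinnertonDyer.Rank1Residual.Iwasawa Summit.BirchSwinnertonDyer.Rank1Residual.Additive
  Summit.BirchSwinnertonDyer.BirchSwinnertonDyer.Theorems.UniversalToricDescentAcDualMuZero

universe u

/-! ### §0 The residual count IS `λ` plus the finite part: `p^{λ(X)} · #X[p] = #Sel[p]` for `X = X_ac^Σ(E)` -/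

section Herbrand

variable {K : Type} [Field K] [NumberField K] (W : WeierstrassCurve K) [W.IsElliptic] (p : ℕ) [Fact p.Prime]
  (κ : ZpExtension K p) (𝔭 : HeightOneSpectrum (𝓞 K)) (S : Set (HeightOneSpectrum (𝓞 K)))
  (γ : absoluteGaloisGroup K) [Fact (κ.IsTopGenerator γ)]

/-- **`p^{λ(X_ac^Σ(E))} · #X_ac^Σ(E)[p] = #Sel_𝔭^Σ(K_∞, E[p^∞])[p]`** for finite `Σ` whenever the right side is finite — the exact
Herbrand form of Greenberg–Vatsal p. 27 («`λ = dim Sel[p]` when there is no finite submodule») WITHOUT the no-finite-submodule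
hypothesis: `Sel[p]` finite ⟹ `X` torsion, `μ = 0`, finitely generated over `ℤ_p` (UTD); `#(X/pX) = p^{λ} · #X[p]` (RTT Herbrand
count); `#(X/pX) = #(X/(p)X) = #Sel[p]` (Pontryagin, exact: `X` IS the character module of `Sel`). The term `#X[p]` is the order of
the `p`-torsion of the maximal finite `Λ`-submodule. [cite: GreenbergVatsal2000, §2 Prop. (2.8) (proof, p. 27)] [cite: Washington1997, §13.2] -/
theorem pow_lambdaInvariant_mul_natCard_pTorsion_eq (hS : S.Finite)
    (hfin : Set.Finite {s : selmerAc W p κ 𝔭 S | p • s = 0}) :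
    p ^ lambdaInvariant p (XAc W p κ 𝔭 S γ) * Nat.card {x : XAc W p κ 𝔭 S γ // p • x = 0} =
      Nat.card {s : selmerAc W p κ 𝔭 S // p • s = 0} := by
  haveI := XAc.module_finite κ 𝔭 S γ hS (W := W)
  have htor := isTorsion_of_finite_pTorsion W p κ 𝔭 S γ hS hfin
  have hμ := muInvariant_eq_zero_of_finite_pTorsion W p κ 𝔭 S γ hS hfin
  letI : Module ℤ_[p] (XAc W p κ 𝔭 S γ) := Module.compHom (XAc W p κ 𝔭 S γ) (algebraMap ℤ_[p] (IwasawaAlgebra p))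
  haveI : IsScalarTower ℤ_[p] (IwasawaAlgebra p) (XAc W p κ 𝔭 S γ) := IsScalarTower.of_compHom _ _ _
  haveI : Module.Finite ℤ_[p] (XAc W p κ 𝔭 S γ) := (muInvariant_eq_zero_iff_finite p (XAc W p κ 𝔭 S γ) htor).mp hμ
  have hsm : ∀ x : XAc W p κ 𝔭 S γ, (p : ℤ_[p]) • x = p • x := fun x ↦ by
    change (algebraMap ℤ_[p] (IwasawaAlgebra p) (p : ℤ_[p])) • x = _
    rw [map_natCast, Nat.cast_smul_eq_nsmul]
  have hH := LambdaLowerBound.natCard_quotient_eq_pow_lambdaInvariant_mul_natCard_ker p (XAc W p κ 𝔭 S γ)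
  have h2 : Nat.card (XAc W p κ 𝔭 S γ ⧸ LinearMap.range (LinearMap.lsmul ℤ_[p] (XAc W p κ 𝔭 S γ) p)) =
      Nat.card (XAc W p κ 𝔭 S γ ⧸ (Ideal.span {(p : ℤ_[p])} • ⊤ : Submodule ℤ_[p] (XAc W p κ 𝔭 S γ))) :=
    Nat.card_congr (Submodule.quotEquivOfEq _ _
      (LambdaLowerBound.span_smul_top_eq_range_lsmul p (XAc W p κ 𝔭 S γ)).symm).toEquiv
  have h3 : Nat.card (XAc W p κ 𝔭 S γ ⧸ (Ideal.span {(p : ℤ_[p])} • ⊤ : Submodule ℤ_[p] (XAc W p κ 𝔭 S γ))) =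
      Nat.card (XAc W p κ 𝔭 S γ ⧸
        (Ideal.span {PowerSeries.C (p : ℤ_[p])} • ⊤ : Submodule (IwasawaAlgebra p) (XAc W p κ 𝔭 S γ))) := by
    change Nat.card (XAc W p κ 𝔭 S γ ⧸ (Ideal.span {(p : ℤ_[p])} • ⊤ :
        Submodule ℤ_[p] (XAc W p κ 𝔭 S γ)).toAddSubgroup) =
      Nat.card (XAc W p κ 𝔭 S γ ⧸ (Ideal.span {PowerSeries.C (p : ℤ_[p])} • ⊤ :
        Submodule (IwasawaAlgebra p) (XAc W p κ 𝔭 S γ)).toAddSubgroup)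
    rw [PrintCFram.LambdaResidualBound.toAddSubgroup_pSmul_eq p (XAc W p κ 𝔭 S γ)]
  have h4 : Nat.card (XAc W p κ 𝔭 S γ ⧸
        (Ideal.span {PowerSeries.C (p : ℤ_[p])} • ⊤ : Submodule (IwasawaAlgebra p) (XAc W p κ 𝔭 S γ))) =
      Nat.card {s : selmerAc W p κ 𝔭 S // p • s = 0} := by
    rw [show (Ideal.span {PowerSeries.C (p : ℤ_[p])} : Ideal (IwasawaAlgebra p)) = augIdealP p from rfl,
      natCard_quotient_augIdealP_smul_top_eq_natCard_modN p,
      show Nat.card (ModN (XAc W p κ 𝔭 S γ) p) = Nat.card (ModN (CharacterModule (selmerAc W p κ 𝔭 S)) p) from rfl,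
      natCard_modN_characterModule_eq p]
    exact Nat.card_congr (Equiv.subtypeEquivRight fun s ↦ AddSubgroup.torsionBy.nsmul_iff)
  have h5 : Nat.card (LinearMap.ker (LinearMap.lsmul ℤ_[p] (XAc W p κ 𝔭 S γ) p)) =
      Nat.card {x : XAc W p κ 𝔭 S γ // p • x = 0} :=
    Nat.card_congr (Equiv.subtypeEquivRight fun x ↦ by rw [LinearMap.mem_ker, LinearMap.lsmul_apply, hsm])
  rw [← h5, ← hH, h2, h3, h4]

end Herbrand

/-! ### §1 `λ`-currency along a stable `Φ ≤ E[p]`, anomalous `𝔭` allowed -/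

section Curve

variable {K : Type} [Field K] [NumberField K] (W : WeierstrassCurve K) [W.IsElliptic] {p : ℕ}
  [Fact p.Prime] (κ : ZpExtension K p)

/-- **`#R(E[p]) ≤ #R(Φ) · #R(E[p]/Φ) · #((E[p]/Φ)^{G_{K_{∞,𝔭}}})^{p^c}`** — the upper count for `E[p]` with the local error at the
fixed points of `ker κ ⊓ D_𝔭` on the quotient (file 3 §2 for `B = E[p]`): any number field, any `ℤ_p`-extension, `Σ ⊇` the bad
places prime to `p`, `p^c` elements controlling the places above `𝔭` (`hreps`). At a non-anomalous `𝔭` the last factor is `1`.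
[cite: KellerYin2024, Thm. 1.4.1 (arXiv:2402.12781v2 §1.4)] [cite: CastellaGrossiLeeSkinner2022, Prop. 17 (arXiv:2008.02571 §1.4)] -/
theorem natCard_residualSelmer_torsion_le_of_stableSubgroup_fixed
    {𝔭 : HeightOneSpectrum (𝓞 K)} (h𝔭 : ((p : ℕ) : 𝓞 K) ∈ 𝔭.asIdeal) {S : Set (HeightOneSpectrum (𝓞 K))}
    (hS : ∀ v : HeightOneSpectrum (𝓞 K), v ∉ S → ((p : ℕ) : 𝓞 K) ∉ v.asIdeal → W.HasGoodReductionAt v)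
    (Φ : StableSubgroup (absoluteGaloisGroup K) (W.geomTorsion (p : ℤ)))
    (c : ℕ) (τ : ℕ → absoluteGaloisGroup K)
    (hreps : ∀ x : Literature.NumberTheory.EllipticCurves.subgroupH1 κ.kerSubgroup Φ.Sub,
      (∀ i, i < p ^ c → resOfLe Φ.Sub (inf_le_left : κ.kerSubgroup ⊓ decomp 𝔭 ≤ κ.kerSubgroup)
        (conjH1 κ.kerSubgroup Φ.Sub (τ i) x) = 0) →
      ∀ σ : absoluteGaloisGroup K, resOfLe Φ.Sub (inf_le_left : κ.kerSubgroup ⊓ decomp 𝔭 ≤ κ.kerSubgroup)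
        (conjH1 κ.kerSubgroup Φ.Sub σ x) = 0)
    (hΦ : (datumStrictSelmer κ.kerSubgroup Φ.Sub p (AcSelmer.bdpData Φ.Sub p 𝔭) S :
      Set (Literature.NumberTheory.EllipticCurves.subgroupH1 κ.kerSubgroup Φ.Sub)).Finite)
    (hΨ : (datumStrictSelmer κ.kerSubgroup Φ.Quot p (AcSelmer.bdpData Φ.Quot p 𝔭) S :
      Set (Literature.NumberTheory.EllipticCurves.subgroupH1 κ.kerSubgroup Φ.Quot)).Finite) :
    Nat.card (datumStrictSelmer κ.kerSubgroup (W.geomTorsion (p : ℤ)) p (AcSelmer.bdpData _ p 𝔭) S) ≤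
      Nat.card (datumStrictSelmer κ.kerSubgroup Φ.Sub p (AcSelmer.bdpData Φ.Sub p 𝔭) S) *
        Nat.card (datumStrictSelmer κ.kerSubgroup Φ.Quot p (AcSelmer.bdpData Φ.Quot p 𝔭) S) *
          Nat.card {y : Φ.Quot // ∀ g : ↥(κ.kerSubgroup ⊓ decomp 𝔭), g • y = y} ^ (p ^ c) := by
  haveI : Finite Φ.Quot := ResidualDevissageCountLower.finite_quot_stableSubgroup W Φ
  refine ResidualDevissageCountSharp.natCard_datumStrictSelmer_le_of_devissage_fixed κ 𝔭 S h𝔭 Φ.incl Φ.incl_smul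
    Φ.incl_injective Φ.proj Φ.proj_smul Φ.proj_incl Φ.proj_surjective
    (fun b hb ↦ AddMonoidHom.mem_range.mp (Φ.mem_range_incl_of_proj_eq_zero b hb)) (continuous_smul_geomTorsion W (p : ℤ))
    ?_ c τ hreps hΦ hΨ
  intro v hvS hvp
  exact resH1Hom_id_injective_of_smul_eq (G := ↥(inertiaIn κ.kerSubgroup v)) Φ.incl (fun _ a ↦ Φ.incl_smul _ a)
    Φ.incl_injective (fun τ' b ↦ CumulativeHeegnerInclusionAtThreeStubB1DevissageCurve.inertiaIn_smul_geomTorsion_eq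
      W p κ.kerSubgroup (hS v hvS hvp) hvp τ' b)

variable (γ : absoluteGaloisGroup K) [Fact (κ.IsTopGenerator γ)]

/-- **`p^{λ(X_ac^Σ(E))} · #X_ac^Σ(E)[p] ≤ #R(Φ) · #R(E[p]/Φ) · #((E[p]/Φ)^{G_{K_{∞,𝔭}}})^{p^c}`** — Keller–Yin Thm. 1.4.1's «`≤`» in λ-currency WITHOUT
the non-anomalous clause: `p` odd, `Σ` finite containing the bad places prime to `p`, `𝔭 ∋ p` with `D_𝔭 ⊄ ker κ` (Brink), (L)
`E[p^∞]^{G_{K_{∞,𝔭}}}` without `p`-torsion, the two residual groups finite. Chain: `p^λ · #X[p] = #Sel[p]` (§0, from `Sel[p]`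
finite = g4's dévissage without (S)), `#Sel[p] = #R(E[p])` (UTD, (L)), and the count above.
[cite: KellerYin2024, Thm. 1.4.1 (arXiv:2402.12781v2 §1.4)] [cite: GreenbergVatsal2000, §2 Prop. (2.8)]
[cite: CastellaGrossiLeeSkinner2022, Thm. 3.2.1, Props. 17–18 (arXiv:2008.02571)] -/
theorem pow_lambdaInvariant_le_of_stableSubgroup_fixed (hp2 : p ≠ 2)
    {𝔭 : HeightOneSpectrum (𝓞 K)} (h𝔭 : ((p : ℕ) : 𝓞 K) ∈ 𝔭.asIdeal) (h𝔭dec : ¬ (decomp 𝔭 ≤ κ.kerSubgroup))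
    {S : Set (HeightOneSpectrum (𝓞 K))} (hSfin : S.Finite)
    (hS : ∀ v : HeightOneSpectrum (𝓞 K), v ∉ S → ((p : ℕ) : 𝓞 K) ∉ v.asIdeal → W.HasGoodReductionAt v)
    (hL : ∀ m : W.geomPrimaryTorsion p, (∀ σ ∈ κ.kerSubgroup ⊓ decomp 𝔭, σ • m = m) → p • m = 0 → m = 0)
    (Φ : StableSubgroup (absoluteGaloisGroup K) (W.geomTorsion (p : ℤ)))
    (c : ℕ) (τ : ℕ → absoluteGaloisGroup K)
    (hreps : ∀ x : Literature.NumberTheory.EllipticCurves.subgroupH1 κ.kerSubgroup Φ.Sub,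
      (∀ i, i < p ^ c → resOfLe Φ.Sub (inf_le_left : κ.kerSubgroup ⊓ decomp 𝔭 ≤ κ.kerSubgroup)
        (conjH1 κ.kerSubgroup Φ.Sub (τ i) x) = 0) →
      ∀ σ : absoluteGaloisGroup K, resOfLe Φ.Sub (inf_le_left : κ.kerSubgroup ⊓ decomp 𝔭 ≤ κ.kerSubgroup)
        (conjH1 κ.kerSubgroup Φ.Sub σ x) = 0)
    (hΦ : (datumStrictSelmer κ.kerSubgroup Φ.Sub p (AcSelmer.bdpData Φ.Sub p 𝔭) S :
      Set (Literature.NumberTheory.EllipticCurves.subgroupH1 κ.kerSubgroup Φ.Sub)).Finite)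
    (hΨ : (datumStrictSelmer κ.kerSubgroup Φ.Quot p (AcSelmer.bdpData Φ.Quot p 𝔭) S :
      Set (Literature.NumberTheory.EllipticCurves.subgroupH1 κ.kerSubgroup Φ.Quot)).Finite) :
    p ^ lambdaInvariant p (XAc W p κ 𝔭 S γ) * Nat.card {x : XAc W p κ 𝔭 S γ // p • x = 0} ≤
      Nat.card (datumStrictSelmer κ.kerSubgroup Φ.Sub p (AcSelmer.bdpData Φ.Sub p 𝔭) S) *
        Nat.card (datumStrictSelmer κ.kerSubgroup Φ.Quot p (AcSelmer.bdpData Φ.Quot p 𝔭) S) *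
          Nat.card {y : Φ.Quot // ∀ g : ↥(κ.kerSubgroup ⊓ decomp 𝔭), g • y = y} ^ (p ^ c) := by
  have hfin := ResidualDevissageFiniteKernel.finite_selmerAc_pTorsion_of_line_devissage_of_finite W κ h𝔭 h𝔭dec hS Φ hΦ hΨ
  have h2 := UniversalToricDescentResidualSelmerExact.natCard_residualSelmer_eq_natCard_selmerAc_pTorsion W κ hp2 h𝔭 hS hL
  rw [pow_lambdaInvariant_mul_natCard_pTorsion_eq W p κ 𝔭 S γ hSfin hfin, ← h2]
  exact natCard_residualSelmer_torsion_le_of_stableSubgroup_fixed W κ h𝔭 hS Φ c τ hreps hΦ hΨ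

/-- **`#R(Φ) · #R(E[p]/Φ) ≤ p^{λ(X_ac^Σ(E))} · #X_ac^Σ(E)[p] · #(E[p]/Φ)^{G_{K_∞}}`** — the «`≥`» half in λ-currency, GIVEN the
residual surjectivity `R(E[p]) ↠ R(E[p]/Φ)` (shadow of PW A.2), with NO «no finite submodule» hypothesis: the finite part of `X`
appears as the explicit factor `#X[p]` (§0), `= 1` exactly when `X` has no non-zero finite `Λ`-submodule. `p` odd, (L), `Σ` finite
⊇ bad places prime to `p`, `R(E[p])` finite. [cite: KellerYin2024, Thm. 1.4.1, Rem. 1.4.2 (arXiv:2402.12781v2 §1.4)]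
[cite: GreenbergVatsal2000, §2 Prop. (2.8) (p. 27)] -/
theorem mul_natCard_le_pow_lambdaInvariant_mul_of_surjective_fixed (hp2 : p ≠ 2)
    {𝔭 : HeightOneSpectrum (𝓞 K)} (h𝔭 : ((p : ℕ) : 𝓞 K) ∈ 𝔭.asIdeal)
    {S : Set (HeightOneSpectrum (𝓞 K))} (hSfin : S.Finite)
    (hS : ∀ v : HeightOneSpectrum (𝓞 K), v ∉ S → ((p : ℕ) : 𝓞 K) ∉ v.asIdeal → W.HasGoodReductionAt v)
    (hL : ∀ m : W.geomPrimaryTorsion p, (∀ σ ∈ κ.kerSubgroup ⊓ decomp 𝔭, σ • m = m) → p • m = 0 → m = 0)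
    (Φ : StableSubgroup (absoluteGaloisGroup K) (W.geomTorsion (p : ℤ)))
    (hE : (datumStrictSelmer κ.kerSubgroup (W.geomTorsion (p : ℤ)) p (AcSelmer.bdpData _ p 𝔭) S :
      Set (Literature.NumberTheory.EllipticCurves.subgroupH1 κ.kerSubgroup (W.geomTorsion (p : ℤ)))).Finite)
    (hsurjR : ∀ z ∈ datumStrictSelmer κ.kerSubgroup Φ.Quot p (AcSelmer.bdpData Φ.Quot p 𝔭) S,
      ∃ y ∈ datumStrictSelmer κ.kerSubgroup (W.geomTorsion (p : ℤ)) p (AcSelmer.bdpData _ p 𝔭) S,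
        resH1Hom (ContinuousMonoidHom.id κ.kerSubgroup) Φ.proj (fun _ b ↦ Φ.proj_smul _ b) y = z) :
    Nat.card (datumStrictSelmer κ.kerSubgroup Φ.Sub p (AcSelmer.bdpData Φ.Sub p 𝔭) S) *
        Nat.card (datumStrictSelmer κ.kerSubgroup Φ.Quot p (AcSelmer.bdpData Φ.Quot p 𝔭) S) ≤
      p ^ lambdaInvariant p (XAc W p κ 𝔭 S γ) * Nat.card {x : XAc W p κ 𝔭 S γ // p • x = 0} *
        Nat.card {y : Φ.Quot // ∀ g : ↥κ.kerSubgroup, g • y = y} := by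
  have h2 := UniversalToricDescentResidualSelmerExact.natCard_residualSelmer_eq_natCard_selmerAc_pTorsion W κ hp2 h𝔭 hS hL
  haveI : Finite (datumStrictSelmer κ.kerSubgroup (W.geomTorsion (p : ℤ)) p (AcSelmer.bdpData _ p 𝔭) S) := hE.to_subtype
  have hfin : Set.Finite {s : selmerAc W p κ 𝔭 S | p • s = 0} := by
    refine Set.finite_coe_iff.mp (Nat.finite_of_card_ne_zero ?_)
    change Nat.card {s : selmerAc W p κ 𝔭 S // p • s = 0} ≠ 0
    rw [← h2]
    exact (Nat.card_pos (α := datumStrictSelmer κ.kerSubgroup (W.geomTorsion (p : ℤ)) p (AcSelmer.bdpData _ p 𝔭) S)).ne'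
  rw [pow_lambdaInvariant_mul_natCard_pTorsion_eq W p κ 𝔭 S γ hSfin hfin, ← h2]
  haveI : Finite Φ.Quot := ResidualDevissageCountLower.finite_quot_stableSubgroup W Φ
  exact ResidualDevissageCountSharp.natCard_mul_natCard_le_of_surjective_fixed κ 𝔭 S Φ.incl Φ.incl_smul
    Φ.incl_injective Φ.proj Φ.proj_smul Φ.proj_incl
    (fun b hb ↦ AddMonoidHom.mem_range.mp (Φ.mem_range_incl_of_proj_eq_zero b hb)) hE hsurjR

end Curve

/-! ### §2 The non-split multiplicative Eisenstein datum: the fixed-vector clause for free -/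

section Nonsplit

/-- **At a NON-SPLIT multiplicative odd Eisenstein prime the quotient clause holds up the tower.** `W/ℚ` globally minimal,
`p` odd, `p ‖ N` NON-SPLIT, `E[p]` reducible; `K` imaginary quadratic with `(p)` split, `v̄ ∣ p`; `κ` ANY `ℤ_p`-extension of `K`.
Then there is a `Γ_K`-stable `S ≤ E_K[p]` (the base change of a rational line) with `#S = #(E_K[p]/S) = p` and NO non-zero vector
of `E_K[p]/S` fixed by `ker κ ⊓ D_{v̄}`: p626493 §1 (`D_𝔓` acts non-trivially on `E[p]/Φ` at every `𝔓 ∣ p`, twisted Tate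
uniformisation), CHL `LineBaseChange` (degree-one transport to `D_{v̄}`, `e = f = 1`) and `TowerFixed` (order prime to `p` versus the
pro-`p` co-kernel). The first half of g4's `residualFinite_of_prop14_of_not_split`, isolated for counting.
[cite: GreenbergVatsal2000, §2 pp. 14–15] [cite: SilvermanATAEC1994, Ch. V Thm. 5.3, Cor. 5.4]
[cite: CastellaGrossiLeeSkinner2022, Prop. 17 (arXiv:2008.02571 §1.4), clause ψ|_{G_p} ≠ 1] -/
theorem exists_stableSubgroup_noFixed_of_not_split
    {p : ℕ} [hp : Fact p.Prime] (W : WeierstrassCurve ℚ) [W.IsElliptic] [W.IsGloballyMinimal]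
    (K : Type) [Field K] [NumberField K] (vbar : HeightOneSpectrum (𝓞 K)) (κ : ZpExtension K p)
    (hp2 : 2 < p) (hmult : Mult W p) (hns : ¬ W.HasSplitMultiplicativeReductionAtPrime p)
    (hred : Red W p) (hK : IsImaginaryQuadratic K)
    (hsplit : ((Ideal.span {(p : ℤ)}).primesOver (𝓞 K)).ncard = 2)
    (hvbar : ((p : ℕ) : 𝓞 K) ∈ vbar.asIdeal) :
    ∃ S : StableSubgroup (absoluteGaloisGroup K) ((W.baseChange K).geomTorsion ((p : ℕ) : ℤ)),
      Nat.card S.Sub = p ∧ Nat.card S.Quot = p ∧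
        ∀ y : S.Quot, (∀ g : ↥(κ.kerSubgroup ⊓ decomp vbar), g • y = y) → y = 0 := by
  have hpp : p.Prime := hp.out
  have hp2' : p ≠ 2 := by omega
  haveI hEK : (W.baseChange K).IsElliptic := inferInstanceAs (W.map (algebraMap ℚ K)).IsElliptic
  haveI : IsGalois ℚ K := isGalois_of_finrank_eq_two K hK.1
  have he : vbar.asIdeal.ramificationIdx (𝓞 ℚ) = 1 :=
    ramificationIdx_eq_one_of_card_primesOver K p hK.1 hsplit vbar hvbar
  have hf : vbar.asIdeal.inertiaDeg (𝓞 ℚ) = 1 :=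
    inertiaDeg_eq_one_of_card_primesOver K p hK.1 hsplit vbar hvbar
  set v : HeightOneSpectrum (𝓞 ℚ) := vbar.under (𝓞 ℚ) with hv
  have hw : vbar.asIdeal.under (𝓞 ℚ) = v.asIdeal := by rw [hv, HeightOneSpectrum.under_asIdeal]
  have hpv : ((p : ℕ) : 𝓞 ℚ) ∈ v.asIdeal := natCast_mem_under K p vbar hvbar
  obtain ⟨Φ, hΦ⟩ := exists_isRationalLine_of_not_irr W p hred
  have hcell : ∀ 𝔓 ∈ v.primesAbove,
      (¬ ∀ g ∈ 𝔓.decompositionSubgroup (absoluteGaloisGroup ℚ), ∀ P ∈ Φ, g • P = P) ∧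
        (¬ ∀ g ∈ 𝔓.decompositionSubgroup (absoluteGaloisGroup ℚ),
          ∀ P : geomTorsion W (p : ℤ), g • P - P ∈ Φ) :=
    fun 𝔓 h𝔓 ↦ KellerYinLemma511NonsplitOfPrint.not_fix_and_not_quot_of_not_split_of_mem_primesAbove W p hp2'
      hmult hns hpv hΦ h𝔓
  obtain ⟨t, ht⟩ := exists_geomTorsion_baseChange_equiv W K ((p : ℕ) : ℤ)
  have ht' : ∀ (σ : absoluteGaloisGroup K) (P : W.geomTorsion ((p : ℕ) : ℤ)),
      t (absGaloisRestrict ℚ K σ • P) = σ • t P := fun σ P ↦ by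
    rw [← resGal_eq_absGaloisRestrict]; exact ht σ P
  obtain ⟨S, hS, hcardS⟩ := exists_stableSubgroup_corr Φ t ht' hΦ.2
  have hSub : Nat.card S.Sub = p := by rw [hcardS, hΦ.1]
  have hEp : Nat.card ((W.baseChange K).geomTorsion ((p : ℕ) : ℤ)) = p ^ 2 :=
    (W.baseChange K).natCard_geomTorsion_prime_eq_sq hpp
  have hQuot : Nat.card S.Quot = p := by
    have h := S.natCard_eq_mul
    rw [hEp, hSub, sq] at h
    exact (Nat.eq_of_mul_eq_mul_right hpp.pos h).symm
  have hnon2 : ¬ ∀ γ ∈ decomp vbar, ∀ y : S.Quot, γ • y = y :=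
    not_forall_decomp_smul_quot_eq_of_corr Φ t ht' S hS
      (not_forall_decomp_smul_sub_mem K Φ hw he hf fun 𝔓 h𝔓 ↦ (hcell 𝔓 h𝔓).2)
  exact ⟨S, hSub, hQuot, eq_zero_of_fixed_of_not_forall_decomp_smul_eq κ vbar hQuot hnon2⟩

/-- **`p^{λ(X_ac^Σ(E_K))} ≤ #R(S) · #R(E_K[p]/S)` at a NON-SPLIT multiplicative Eisenstein datum, with NO error term.** Binders:
`W/ℚ` globally minimal, `2 < p`, `p ‖ N` non-split, `E[p]` reducible; `K` imaginary quadratic, `(p)` split, `v̄ ∋ p`; `κ` the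
anticyclotomic `ℤ_p`-extension (Brink: `D_{v̄} ⊄ ker κ`) with topological generator `γ`; `Σ` finite containing the bad places of
`E_K` prime to `p`; (L) `E_K[p^∞]^{G_{K_{∞,v̄}}}` without `p`-torsion. Conclusion: for the `S` of
`exists_stableSubgroup_noFixed_of_not_split`, finiteness of `R(S)`, `R(E_K[p]/S)` implies the bound (PrintCFram
`pow_lambdaInvariant_le_mul_natCard_residualSelmer_of_line` with its clause discharged). This is the «`≤`» half of Keller–Yin
Thm. 1.4.1's λ-clause for the non-split half of crux 4, the two residual counts being CHARACTER-level (CGLS Prop. 14 finiteness,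
p626493). [cite: KellerYin2024, Thm. 1.4.1, Lemma 5.1.1 (arXiv:2402.12781v2)] [cite: CastellaGrossiLeeSkinner2022, Thm. 3.2.1 (arXiv:2008.02571 §3)]
[cite: Brink2007, Cor. 1] -/
theorem pow_lambdaInvariant_le_of_not_split
    {p : ℕ} [hp : Fact p.Prime] (W : WeierstrassCurve ℚ) [W.IsElliptic] [W.IsGloballyMinimal]
    (K : Type) [Field K] [NumberField K] (vbar : HeightOneSpectrum (𝓞 K)) (κ : ZpExtension K p)
    (γ : absoluteGaloisGroup K) [Fact (κ.IsTopGenerator γ)]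
    (hp2 : 2 < p) (hmult : Mult W p) (hns : ¬ W.HasSplitMultiplicativeReductionAtPrime p)
    (hred : Red W p) (hK : IsImaginaryQuadratic K)
    (hsplit : ((Ideal.span {(p : ℤ)}).primesOver (𝓞 K)).ncard = 2)
    (hvbar : ((p : ℕ) : 𝓞 K) ∈ vbar.asIdeal) (hκ : κ.IsAnticyclotomic)
    {Sg : Set (HeightOneSpectrum (𝓞 K))} (hSgfin : Sg.Finite)
    (hSg : ∀ w : HeightOneSpectrum (𝓞 K), w ∉ Sg → ((p : ℕ) : 𝓞 K) ∉ w.asIdeal →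
      (W.baseChange K).HasGoodReductionAt w)
    (hL : ∀ m : (W.baseChange K).geomPrimaryTorsion p,
      (∀ σ ∈ κ.kerSubgroup ⊓ decomp vbar, σ • m = m) → p • m = 0 → m = 0) :
    ∃ S : StableSubgroup (absoluteGaloisGroup K) ((W.baseChange K).geomTorsion ((p : ℕ) : ℤ)),
      Nat.card S.Sub = p ∧ Nat.card S.Quot = p ∧
        (∀ y : S.Quot, (∀ g : ↥(κ.kerSubgroup ⊓ decomp vbar), g • y = y) → y = 0) ∧
        ((datumStrictSelmer κ.kerSubgroup S.Sub p (AcSelmer.bdpData S.Sub p vbar) Sg :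
            Set (subgroupH1 κ.kerSubgroup S.Sub)).Finite →
          (datumStrictSelmer κ.kerSubgroup S.Quot p (AcSelmer.bdpData S.Quot p vbar) Sg :
            Set (subgroupH1 κ.kerSubgroup S.Quot)).Finite →
          p ^ lambdaInvariant p (XAc (W.baseChange K) p κ vbar Sg γ) ≤
            Nat.card (datumStrictSelmer κ.kerSubgroup S.Sub p (AcSelmer.bdpData S.Sub p vbar) Sg) *
              Nat.card (datumStrictSelmer κ.kerSubgroup S.Quot p (AcSelmer.bdpData S.Quot p vbar) Sg)) := by
  have hp2' : p ≠ 2 := by omega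
  haveI hEK : (W.baseChange K).IsElliptic := inferInstanceAs (W.map (algebraMap ℚ K)).IsElliptic
  obtain ⟨S, hSub, hQuot, hfix⟩ := exists_stableSubgroup_noFixed_of_not_split W K vbar κ hp2 hmult hns hred hK
    hsplit hvbar
  have h𝔭dec : ¬ (decomp vbar ≤ κ.kerSubgroup) :=
    ZpExtension.decomp_not_le_kerSubgroup_above_of_isAnticyclotomic_holds K p hK hp2' κ hκ vbar hvbar
  exact ⟨S, hSub, hQuot, hfix, fun hΦ hΨ ↦
    PrintCFram.LambdaResidualBound.pow_lambdaInvariant_le_mul_natCard_residualSelmer_of_line (W.baseChange K) p κ vbar γ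
      hp2' hvbar h𝔭dec hSgfin hSg S hfix hL hΦ hΨ⟩

end Nonsplit

end Summit.BirchSwinnertonDyer.BirchSwinnertonDyer.Theorems.ResidualDevissageCountNonsplit

end
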